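import Mathlib.Analysis.SpecialFunctions.Pow.Deriv
import Mathlib.Analysis.Calculus.Deriv.MeanValue
import Mathlib.Analysis.Complex.ExponentialBounds
import HarnessLib

/-!
# The analysis facts behind Thm. 7.1 / Thm. 1.4 of Alman–Li 2026 (§9, Lemmas 9.1 and 9.2)

Topic `Literature/Computability/AlgebraicComplexity` (family `MatrixMultiplication`). Source: J. Alman,
B. Li, *Asymptotic Rank Speedup Theorems, Revisited*, arXiv:2605.21738 (2026), §9 "Analysis facts"
(held text `paper:arxiv-2605.21738`, p0025 L1–73), the two monotonicity lemmas invoked in the proof of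
Thm. 7.1 (`R̃(T) ≤ sqrt(d^{4ω/3} + d^{2ω/3} − (d³−d²)^{ω/3})` for every `d × d × d` tensor, `d ≥ 3`;
p0018 L57–66: "One can show that the function `F(θ) = d^{ϖ+θ} + d^{2θ} − (d³−d²)^θ`, `θ ∈ [0, ϖ/3]` is
maximized at `θ = ϖ/3` (the proof is deferred to (lem:varpi)). Furthermore, by
(lem:f_varpi_increasing), the quantity `F(ϖ/3)` is increasing in `ϖ` on `[2, ω]`."):

* **Lemma 9.1.** "Let `d ≥ 3` and `ϖ ≥ 2`. Define `f(θ) = d^{ϖ+θ} + d^{2θ} − (d³−d²)^θ`,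
  `θ ∈ [0, ϖ/3]`. Then `f` is strictly increasing on `[0, ϖ/3]`, hence
  `max_{0≤θ≤ϖ/3} f(θ) = f(ϖ/3)`."
* **Lemma 9.2.** "Let `d ≥ 3`. For `ϖ ≥ 2`, define `F(ϖ) ≔ d^{4ϖ/3} + d^{2ϖ/3} − (d³−d²)^{ϖ/3}`. Then
  `F` is strictly increasing on `[2,3]`."

Both are PROVED here (`AlmanLi2026.lemma91`, `AlmanLi2026.lemma91_le`, `AlmanLi2026.lemma92`,
`AlmanLi2026.lemma92_le`; APPEND 1: Lemmas 9.3 / 9.4 as `AlmanLi2026.lemma93`,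
`AlmanLi2026.lemma94`), for REAL `d ≥ 3` (the paper's `d` is an integer; the proofs do not use
it). Proof as printed — positivity of the derivative after bounding `ln(d³−d²)·(d³−d²)^θ` by
`3 ln d · d^{3θ}` — with the final positivity steps done by elementary algebra instead of the paper's
auxiliary monotonicity remarks: for Lemma 9.1, with `Y = d^{ϖ/3} > 2` and `y = d^θ ∈ [1, Y]`,
`d^{ϖ−θ} + 2 − 3d^θ ≥ Y² + 2 − 3Y = (Y−1)(Y−2) > 0`; for Lemma 9.2, `4z² − 3z + 2 > 0` for every real
`z = d^{ϖ/3}`.  No definitions, no named facts; Mathlib-only imports.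

## References

* J. Alman, B. Li, *Asymptotic Rank Speedup Theorems, Revisited*, arXiv:2605.21738 (2026), §9,
  Lemma 9.1, Lemma 9.2 (p0025); Thm. 7.1 (p0018). [AlmanLi2026]
-/

noncomputable section

namespace Literature.Computability.AlgebraicComplexity

namespace AlmanLi2026

open Real Set

/-! ## Lemma 9.1 -/

/-- The derivative of `θ ↦ d^{ϖ+θ} + d^{2θ} − c^θ` (`d, c > 0`). [cite: AlmanLi2026, Lemma 9.1 (proof: "Differentiate")] -/
theorem hasDerivAt_lemma91 {d c : ℝ} (hd : 0 < d) (hc : 0 < c) (ϖ θ : ℝ) :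
    HasDerivAt (fun θ : ℝ => d ^ (ϖ + θ) + d ^ (2 * θ) - c ^ θ)
      (Real.log d * d ^ (ϖ + θ) + 2 * Real.log d * d ^ (2 * θ) - Real.log c * c ^ θ) θ := by
  have h1 : HasDerivAt (fun θ : ℝ => ϖ + θ) 1 θ := by
    simpa using (hasDerivAt_id θ).const_add ϖ
  have h2 : HasDerivAt (fun θ : ℝ => 2 * θ) 2 θ := by
    simpa using (hasDerivAt_id θ).const_mul (2 : ℝ)
  have h3 : HasDerivAt (fun θ : ℝ => θ) 1 θ := hasDerivAt_id θ
  have e : HasDerivAt (fun θ : ℝ => d ^ (ϖ + θ) + d ^ (2 * θ) - c ^ θ)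
      (Real.log d * 1 * d ^ (ϖ + θ) + Real.log d * 2 * d ^ (2 * θ) - Real.log c * 1 * c ^ θ) θ :=
    ((h1.const_rpow hd).add (h2.const_rpow hd)).sub (h3.const_rpow hc)
  exact e.congr_deriv (by ring)

/-- **Alman–Li 2026, Lemma 9.1.** For real `d ≥ 3` and `ϖ ≥ 2`, the function
`f(θ) = d^{ϖ+θ} + d^{2θ} − (d³−d²)^θ` is strictly increasing on `[0, ϖ/3]`.
[cite: AlmanLi2026, Lemma 9.1] -/
theorem lemma91 {d ϖ : ℝ} (hd : 3 ≤ d) (hϖ : 2 ≤ ϖ) :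
    StrictMonoOn (fun θ : ℝ => d ^ (ϖ + θ) + d ^ (2 * θ) - (d ^ 3 - d ^ 2) ^ θ)
      (Icc 0 (ϖ / 3)) := by
  have hd0 : 0 < d := by linarith
  have hd1 : 1 ≤ d := by linarith
  set c := d ^ 3 - d ^ 2 with hc
  have hc1 : 1 ≤ c := by rw [hc]; nlinarith
  have hc0 : 0 < c := by linarith
  have hcd : c ≤ d ^ (3 : ℝ) := by
    rw [hc, show (3 : ℝ) = ((3 : ℕ) : ℝ) by norm_num, Real.rpow_natCast]; nlinarith
  refine strictMonoOn_of_deriv_pos (convex_Icc _ _)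
    (fun θ _ => (hasDerivAt_lemma91 hd0 hc0 ϖ θ).continuousAt.continuousWithinAt) ?_
  intro θ hθ
  rw [interior_Icc] at hθ
  obtain ⟨hθ0, hθ1⟩ := hθ
  rw [(hasDerivAt_lemma91 hd0 hc0 ϖ θ).deriv]
  -- notation: `y = d^θ`, `Y = d^{ϖ/3}`
  have hL : 0 < Real.log d := Real.log_pos (by linarith)
  have hLc : Real.log c ≤ 3 * Real.log d := by
    rw [← Real.log_rpow hd0]
    exact Real.log_le_log hc0 hcd
  have hLc0 : 0 ≤ Real.log c := Real.log_nonneg hc1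
  have hy0 : 0 < d ^ θ := Real.rpow_pos_of_pos hd0 θ
  have hY0 : 0 < d ^ (ϖ / 3) := Real.rpow_pos_of_pos hd0 _
  -- `c^θ ≤ d^{3θ} = (d^θ)^3`
  have hcθ : c ^ θ ≤ (d ^ θ) ^ (3 : ℕ) := by
    calc c ^ θ ≤ (d ^ (3 : ℝ)) ^ θ := Real.rpow_le_rpow (by linarith) hcd hθ0.le
      _ = (d ^ θ) ^ (3 : ℕ) := by
          rw [← Real.rpow_mul hd0.le, ← Real.rpow_natCast, ← Real.rpow_mul hd0.le]; ring_nf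
  have hcθ0 : 0 ≤ c ^ θ := Real.rpow_nonneg hc0.le θ
  -- `d^{ϖ+θ} = d^{ϖ-θ} · (d^θ)^2`, `d^{2θ} = (d^θ)^2`
  have e1 : d ^ (ϖ + θ) = d ^ (ϖ - θ) * (d ^ θ) ^ (2 : ℕ) := by
    rw [← Real.rpow_natCast, ← Real.rpow_mul hd0.le, ← Real.rpow_add hd0]; ring_nf
  have e2 : d ^ (2 * θ) = (d ^ θ) ^ (2 : ℕ) := by
    rw [← Real.rpow_natCast, ← Real.rpow_mul hd0.le]; ring_nf
  -- `d^{ϖ-θ} ≥ d^{2ϖ/3} = Y^2`, `d^θ ≤ Y`, `Y > 2`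
  have e3 : d ^ (2 * ϖ / 3) = (d ^ (ϖ / 3)) ^ (2 : ℕ) := by
    rw [← Real.rpow_natCast, ← Real.rpow_mul hd0.le]; ring_nf
  have h4 : (d ^ (ϖ / 3)) ^ (2 : ℕ) ≤ d ^ (ϖ - θ) := by
    rw [← e3]
    exact Real.rpow_le_rpow_of_exponent_le hd1 (by linarith)
  have h5 : d ^ θ ≤ d ^ (ϖ / 3) := Real.rpow_le_rpow_of_exponent_le hd1 hθ1.le
  have hY2 : 2 < d ^ (ϖ / 3) := by
    have h23 : (3 : ℝ) ^ ((2 : ℝ) / 3) ≤ d ^ (ϖ / 3) :=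
      (Real.rpow_le_rpow (by norm_num) hd (by norm_num)).trans
        (Real.rpow_le_rpow_of_exponent_le hd1 (by linarith))
    refine lt_of_lt_of_le ?_ h23
    have h9 : ((3 : ℝ) ^ ((2 : ℝ) / 3)) ^ (3 : ℕ) = 9 := by
      rw [← Real.rpow_natCast, ← Real.rpow_mul (by norm_num)]; norm_num
    exact lt_of_pow_lt_pow_left₀ 3 (Real.rpow_nonneg (by norm_num) _) (by rw [h9]; norm_num)
  -- assemble: `f' ≥ log d · (d^θ)^2 · (d^{ϖ-θ} + 2 − 3 d^θ) > 0`
  rw [e1, e2]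
  have hbr : 0 < d ^ (ϖ - θ) + 2 - 3 * d ^ θ := by nlinarith
  have hmain : Real.log c * c ^ θ ≤ 3 * Real.log d * (d ^ θ) ^ (3 : ℕ) :=
    mul_le_mul hLc hcθ hcθ0 (by linarith)
  nlinarith [mul_pos (mul_pos hL (pow_pos hy0 2)) hbr, pow_pos hy0 2, pow_pos hy0 3]

/-- **Lemma 9.1, as used in Thm. 7.1**: `max_{0≤θ≤ϖ/3} f(θ) = f(ϖ/3)`, i.e.
`f(θ) ≤ f(ϖ/3)` for `θ ∈ [0, ϖ/3]`. [cite: AlmanLi2026, Lemma 9.1] -/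
theorem lemma91_le {d ϖ θ : ℝ} (hd : 3 ≤ d) (hϖ : 2 ≤ ϖ) (h0 : 0 ≤ θ) (h1 : θ ≤ ϖ / 3) :
    d ^ (ϖ + θ) + d ^ (2 * θ) - (d ^ 3 - d ^ 2) ^ θ ≤
      d ^ (ϖ + ϖ / 3) + d ^ (2 * (ϖ / 3)) - (d ^ 3 - d ^ 2) ^ (ϖ / 3) := by
  have hmem : θ ∈ Icc 0 (ϖ / 3) := ⟨h0, h1⟩
  have hmem' : ϖ / 3 ∈ Icc 0 (ϖ / 3) := ⟨by linarith, le_rfl⟩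
  exact (lemma91 hd hϖ).monotoneOn hmem hmem' h1

/-! ## Lemma 9.2 -/

/-- The derivative of `ϖ ↦ d^{4ϖ/3} + d^{2ϖ/3} − c^{ϖ/3}` (`d, c > 0`). [cite: AlmanLi2026, Lemma 9.2 (proof: "Differentiate")] -/
theorem hasDerivAt_lemma92 {d c : ℝ} (hd : 0 < d) (hc : 0 < c) (ϖ : ℝ) :
    HasDerivAt (fun ϖ : ℝ => d ^ (4 * ϖ / 3) + d ^ (2 * ϖ / 3) - c ^ (ϖ / 3))
      (Real.log d * (4 / 3) * d ^ (4 * ϖ / 3) + Real.log d * (2 / 3) * d ^ (2 * ϖ / 3)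
        - Real.log c * (1 / 3) * c ^ (ϖ / 3)) ϖ := by
  have h1 : HasDerivAt (fun ϖ : ℝ => 4 * ϖ / 3) (4 / 3) ϖ := by
    have := ((hasDerivAt_id ϖ).const_mul (4 : ℝ)).div_const 3
    simpa using this
  have h2 : HasDerivAt (fun ϖ : ℝ => 2 * ϖ / 3) (2 / 3) ϖ := by
    have := ((hasDerivAt_id ϖ).const_mul (2 : ℝ)).div_const 3
    simpa using this
  have h3 : HasDerivAt (fun ϖ : ℝ => ϖ / 3) (1 / 3) ϖ := by
    have := (hasDerivAt_id ϖ).div_const 3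
    simpa using this
  exact ((h1.const_rpow hd).add (h2.const_rpow hd)).sub (h3.const_rpow hc)

/-- **Alman–Li 2026, Lemma 9.2.** For real `d ≥ 3`, `F(ϖ) = d^{4ϖ/3} + d^{2ϖ/3} − (d³−d²)^{ϖ/3}`
is strictly increasing on `[2, 3]`. [cite: AlmanLi2026, Lemma 9.2] -/
theorem lemma92 {d : ℝ} (hd : 3 ≤ d) :
    StrictMonoOn (fun ϖ : ℝ => d ^ (4 * ϖ / 3) + d ^ (2 * ϖ / 3) - (d ^ 3 - d ^ 2) ^ (ϖ / 3))
      (Icc 2 3) := by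
  have hd0 : 0 < d := by linarith
  set c := d ^ 3 - d ^ 2 with hc
  have hc1 : 1 ≤ c := by rw [hc]; nlinarith
  have hc0 : 0 < c := by linarith
  have hcd : c ≤ d ^ (3 : ℝ) := by
    rw [hc, show (3 : ℝ) = ((3 : ℕ) : ℝ) by norm_num, Real.rpow_natCast]; nlinarith
  refine strictMonoOn_of_deriv_pos (convex_Icc _ _)
    (fun ϖ _ => (hasDerivAt_lemma92 hd0 hc0 ϖ).continuousAt.continuousWithinAt) ?_
  intro ϖ hϖ
  rw [interior_Icc] at hϖ
  obtain ⟨hϖ0, hϖ1⟩ := hϖ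
  rw [(hasDerivAt_lemma92 hd0 hc0 ϖ).deriv]
  have hL : 0 < Real.log d := Real.log_pos (by linarith)
  have hLc : Real.log c ≤ 3 * Real.log d := by
    rw [← Real.log_rpow hd0]
    exact Real.log_le_log hc0 hcd
  have hLc0 : 0 ≤ Real.log c := Real.log_nonneg hc1
  -- `z = d^{ϖ/3} > 0`; `d^{4ϖ/3} = z^4`, `d^{2ϖ/3} = z^2`, `c^{ϖ/3} ≤ z^3`
  have hz0 : 0 < d ^ (ϖ / 3) := Real.rpow_pos_of_pos hd0 _
  have e4 : d ^ (4 * ϖ / 3) = (d ^ (ϖ / 3)) ^ (4 : ℕ) := by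
    rw [← Real.rpow_natCast, ← Real.rpow_mul hd0.le]; ring_nf
  have e2 : d ^ (2 * ϖ / 3) = (d ^ (ϖ / 3)) ^ (2 : ℕ) := by
    rw [← Real.rpow_natCast, ← Real.rpow_mul hd0.le]; ring_nf
  have hcθ : c ^ (ϖ / 3) ≤ (d ^ (ϖ / 3)) ^ (3 : ℕ) := by
    calc c ^ (ϖ / 3) ≤ (d ^ (3 : ℝ)) ^ (ϖ / 3) :=
          Real.rpow_le_rpow (by linarith) hcd (by linarith)
      _ = (d ^ (ϖ / 3)) ^ (3 : ℕ) := by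
          rw [← Real.rpow_mul hd0.le, ← Real.rpow_natCast, ← Real.rpow_mul hd0.le]; ring_nf
  have hcθ0 : 0 ≤ c ^ (ϖ / 3) := Real.rpow_nonneg hc0.le _
  rw [e4, e2]
  have hmain : Real.log c * c ^ (ϖ / 3) ≤ 3 * Real.log d * (d ^ (ϖ / 3)) ^ (3 : ℕ) :=
    mul_le_mul hLc hcθ hcθ0 (by linarith)
  -- `4z² − 3z + 2 > 0` for every real `z`
  have hbr : 0 < 4 * (d ^ (ϖ / 3)) ^ (2 : ℕ) + 2 - 3 * d ^ (ϖ / 3) := by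
    nlinarith [sq_nonneg (d ^ (ϖ / 3) - 3 / 8)]
  nlinarith [mul_pos (mul_pos hL (pow_pos hz0 2)) hbr, pow_pos hz0 2, pow_pos hz0 3,
    pow_pos hz0 4]

/-- **Lemma 9.2, as used in Thm. 7.1** ("the quantity `F(ϖ/3)` is increasing in `ϖ` on `[2, ω]`"):
for `2 ≤ ϖ ≤ ω ≤ 3`, `F(ϖ) ≤ F(ω)`. [cite: AlmanLi2026, Lemma 9.2] -/
theorem lemma92_le {d ϖ ω : ℝ} (hd : 3 ≤ d) (h2 : 2 ≤ ϖ) (hϖ : ϖ ≤ ω) (hω : ω ≤ 3) :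
    d ^ (4 * ϖ / 3) + d ^ (2 * ϖ / 3) - (d ^ 3 - d ^ 2) ^ (ϖ / 3) ≤
      d ^ (4 * ω / 3) + d ^ (2 * ω / 3) - (d ^ 3 - d ^ 2) ^ (ω / 3) :=
  (lemma92 hd).monotoneOn ⟨h2, hϖ.trans hω⟩ ⟨h2.trans hϖ, hω⟩ hϖ

end AlmanLi2026

/-! ## APPEND 1 (lit g28): Lemmas 9.3 and 9.4 — the analysis facts behind Thm. 7.2 / Thm. 1.4

Source: the same §9 (held text p0025 L75–170): **Lemma 9.3.** "Let `d ≥ 3`, `p ∈ ℝ_{≥0}`, and `ϖ ≥ 2`.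
Define `h_ϖ(θ) ≔ d^{ϖ+θ} − (2^θ−1) p d^{2θ}`, `θ ∈ [0, ϖ/3]`. If `p ≤ ⌊d/3⌋`, then `h_ϖ` is strictly
increasing on `[0, ϖ/3]`." — its printed proof uses "since `ϖ ≤ ω < 3` in our applications, also
`θ ≤ 1` and hence `2^θ ≤ 2`", so the lemma is formalised with the extra hypothesis `ϖ ≤ 3` that the proof
needs (this is how Thm. 7.2 applies it: `ϖ ≤ ω ≤ 3`), and with `p ≤ d/3` (implied by the printed
`p ≤ ⌊d/3⌋`; the proof uses only "`p ≤ ⌊d/3⌋ ≤ d/3`").  **Lemma 9.4.** "Let `d ≥ 3`, `p ∈ ℝ_{≥0}`, and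
define for `ϖ ≥ 2`, `g(ϖ) ≔ d^{4ϖ/3} − (2^{ϖ/3}−1) p d^{2ϖ/3}`. If `p ≤ ⌊d/3⌋`, then `g` is strictly
increasing on `[2,3]`."  Closing numerical facts used: `ln 3 > 1` (`e < 3`), `ln 2 < 0.6931471808`,
`3^{1/3} > 1.44`. -/

namespace AlmanLi2026

open Real Set

/-- `ln 3 > 1`, `3^{1/3} > 1.44` and `ln 2 < 0.6931471808`: the numerical inputs of Lemmas 9.3/9.4
("already at `d = 3` the bracket is positive"). [cite: AlmanLi2026, Lemma 9.3 (proof, last display)] -/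
theorem lemma93_numerics : 1 < Real.log 3 ∧ (1.44 : ℝ) < (3 : ℝ) ^ ((1 : ℝ) / 3) ∧
    Real.log 2 < 0.6931471808 := by
  refine ⟨?_, ?_, Real.log_two_lt_d9⟩
  · rw [← Real.log_exp 1]
    exact Real.log_lt_log (Real.exp_pos 1) (by linarith [Real.exp_one_lt_d9])
  · have h3 : ((3 : ℝ) ^ ((1 : ℝ) / 3)) ^ (3 : ℕ) = 3 := by
      rw [← Real.rpow_natCast, ← Real.rpow_mul (by norm_num)]; norm_num
    exact lt_of_pow_lt_pow_left₀ 3 (Real.rpow_nonneg (by norm_num) _) (by rw [h3]; norm_num)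

/-- The derivative of `θ ↦ d^{ϖ+θ} − (2^θ − 1)·p·d^{2θ}` (`d > 0`). [cite: AlmanLi2026, Lemma 9.3 (proof: "Differentiate")] -/
theorem hasDerivAt_lemma93 {d : ℝ} (hd : 0 < d) (p ϖ θ : ℝ) :
    HasDerivAt (fun θ : ℝ => d ^ (ϖ + θ) - ((2 : ℝ) ^ θ - 1) * p * d ^ (2 * θ))
      (Real.log d * d ^ (ϖ + θ) - p * (Real.log 2 * (2 : ℝ) ^ θ * d ^ (2 * θ)
        + ((2 : ℝ) ^ θ - 1) * (2 * Real.log d * d ^ (2 * θ)))) θ := by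
  have h1 : HasDerivAt (fun θ : ℝ => ϖ + θ) 1 θ := by
    simpa using (hasDerivAt_id θ).const_add ϖ
  have h2 : HasDerivAt (fun θ : ℝ => 2 * θ) 2 θ := by
    simpa using (hasDerivAt_id θ).const_mul (2 : ℝ)
  have h3 : HasDerivAt (fun θ : ℝ => θ) 1 θ := hasDerivAt_id θ
  have hu : HasDerivAt (fun θ : ℝ => ((2 : ℝ) ^ θ - 1) * p)
      (Real.log 2 * 1 * (2 : ℝ) ^ θ * p) θ :=
    ((h3.const_rpow (by norm_num : (0 : ℝ) < 2)).sub_const 1).mul_const p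
  have e : HasDerivAt (fun θ : ℝ => d ^ (ϖ + θ) - ((2 : ℝ) ^ θ - 1) * p * d ^ (2 * θ))
      (Real.log d * 1 * d ^ (ϖ + θ) - (Real.log 2 * 1 * (2 : ℝ) ^ θ * p * d ^ (2 * θ)
        + ((2 : ℝ) ^ θ - 1) * p * (Real.log d * 2 * d ^ (2 * θ)))) θ :=
    (h1.const_rpow hd).sub (hu.mul (h2.const_rpow hd))
  exact e.congr_deriv (by ring)

/-- **Alman–Li 2026, Lemma 9.3** (with the proof's standing assumption `ϖ ≤ 3`, i.e. `θ ≤ 1`): for real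
`d ≥ 3`, `0 ≤ p ≤ d/3` and `2 ≤ ϖ ≤ 3`, `h_ϖ(θ) = d^{ϖ+θ} − (2^θ−1) p d^{2θ}` is strictly increasing on
`[0, ϖ/3]`. [cite: AlmanLi2026, Lemma 9.3] -/
theorem lemma93 {d p ϖ : ℝ} (hd : 3 ≤ d) (hp0 : 0 ≤ p) (hp : p ≤ d / 3) (hϖ : 2 ≤ ϖ) (hϖ3 : ϖ ≤ 3) :
    StrictMonoOn (fun θ : ℝ => d ^ (ϖ + θ) - ((2 : ℝ) ^ θ - 1) * p * d ^ (2 * θ))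
      (Icc 0 (ϖ / 3)) := by
  have hd0 : 0 < d := by linarith
  have hd1 : 1 ≤ d := by linarith
  refine strictMonoOn_of_deriv_pos (convex_Icc _ _)
    (fun θ _ => (hasDerivAt_lemma93 hd0 p ϖ θ).continuousAt.continuousWithinAt) ?_
  intro θ hθ
  rw [interior_Icc] at hθ
  obtain ⟨hθ0, hθ1⟩ := hθ
  rw [(hasDerivAt_lemma93 hd0 p ϖ θ).deriv]
  obtain ⟨hlog3, hcbrt, hlog2⟩ := lemma93_numerics
  have hL : 1 < Real.log d := hlog3.trans_le (Real.log_le_log (by norm_num) hd)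
  have hy0 : 0 < d ^ θ := Real.rpow_pos_of_pos hd0 θ
  -- `2^θ ≤ 2`, `2^θ ≥ 1`
  have h2θ : (2 : ℝ) ^ θ ≤ 2 := by
    calc (2 : ℝ) ^ θ ≤ (2 : ℝ) ^ (1 : ℝ) :=
          Real.rpow_le_rpow_of_exponent_le (by norm_num) (by linarith)
      _ = 2 := Real.rpow_one 2
  have h2θ1 : 1 ≤ (2 : ℝ) ^ θ := Real.one_le_rpow (by norm_num) hθ0.le
  -- `d^{ϖ+θ} = d^{ϖ-θ}·(d^θ)^2`, `d^{2θ} = (d^θ)^2`, `d^{ϖ-θ} ≥ d^{4/3} = d · d^{1/3}`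
  have e1 : d ^ (ϖ + θ) = d ^ (ϖ - θ) * (d ^ θ) ^ (2 : ℕ) := by
    rw [← Real.rpow_natCast, ← Real.rpow_mul hd0.le, ← Real.rpow_add hd0]; ring_nf
  have e2 : d ^ (2 * θ) = (d ^ θ) ^ (2 : ℕ) := by
    rw [← Real.rpow_natCast, ← Real.rpow_mul hd0.le]; ring_nf
  have h43 : d * d ^ ((1 : ℝ) / 3) ≤ d ^ (ϖ - θ) := by
    calc d * d ^ ((1 : ℝ) / 3) = d ^ ((4 : ℝ) / 3) := by
          rw [show (4 : ℝ) / 3 = 1 + 1 / 3 by norm_num, Real.rpow_add hd0, Real.rpow_one]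
      _ ≤ d ^ (ϖ - θ) := Real.rpow_le_rpow_of_exponent_le hd1 (by linarith)
  have hc : (1.44 : ℝ) < d ^ ((1 : ℝ) / 3) :=
    hcbrt.trans_le (Real.rpow_le_rpow (by norm_num) hd (by norm_num))
  have hlog2' : 0 < Real.log 2 := Real.log_pos (by norm_num)
  rw [e1, e2]
  -- the bracket `L d^{1/3} − (2/3)(ln 2 + L) > 0`, times `d`
  have hbr : 0 < Real.log d * (d * d ^ ((1 : ℝ) / 3)) - p * (2 * Real.log 2 + 2 * Real.log d) := by
    nlinarith [mul_pos (by linarith : (0 : ℝ) < Real.log d - 1) (by linarith : (0 : ℝ) < d)]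
  have hderiv : p * (Real.log 2 * (2 : ℝ) ^ θ * (d ^ θ) ^ (2 : ℕ)
      + ((2 : ℝ) ^ θ - 1) * (2 * Real.log d * (d ^ θ) ^ (2 : ℕ)))
      ≤ p * (2 * Real.log 2 + 2 * Real.log d) * (d ^ θ) ^ (2 : ℕ) := by
    have hsq : 0 ≤ (d ^ θ) ^ (2 : ℕ) := pow_nonneg hy0.le 2
    rw [mul_assoc p]
    refine mul_le_mul_of_nonneg_left ?_ hp0
    nlinarith [mul_nonneg (by linarith : (0 : ℝ) ≤ 2 - (2 : ℝ) ^ θ) (mul_nonneg hlog2'.le hsq),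
      mul_nonneg (by linarith : (0 : ℝ) ≤ 2 - (2 : ℝ) ^ θ) (mul_nonneg (by linarith : (0:ℝ) ≤ Real.log d) hsq)]
  nlinarith [mul_le_mul_of_nonneg_right h43 (by linarith : (0 : ℝ) ≤ Real.log d),
    mul_pos hbr (pow_pos hy0 2), pow_pos hy0 2,
    mul_le_mul_of_nonneg_right (mul_le_mul_of_nonneg_right h43 (by linarith : (0 : ℝ) ≤ Real.log d))
      (pow_nonneg hy0.le 2)]

/-- The derivative of `ϖ ↦ d^{4ϖ/3} − (2^{ϖ/3} − 1)·p·d^{2ϖ/3}` (`d > 0`). [cite: AlmanLi2026, Lemma 9.4 (proof: "Differentiate")] -/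
theorem hasDerivAt_lemma94 {d : ℝ} (hd : 0 < d) (p ϖ : ℝ) :
    HasDerivAt (fun ϖ : ℝ => d ^ (4 * ϖ / 3) - ((2 : ℝ) ^ (ϖ / 3) - 1) * p * d ^ (2 * ϖ / 3))
      (Real.log d * (4 / 3) * d ^ (4 * ϖ / 3) - p * (Real.log 2 * (1 / 3) * (2 : ℝ) ^ (ϖ / 3)
        * d ^ (2 * ϖ / 3) + ((2 : ℝ) ^ (ϖ / 3) - 1) * (Real.log d * (2 / 3) * d ^ (2 * ϖ / 3)))) ϖ := by
  have h1 : HasDerivAt (fun ϖ : ℝ => 4 * ϖ / 3) (4 / 3) ϖ := by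
    have := ((hasDerivAt_id ϖ).const_mul (4 : ℝ)).div_const 3
    simpa using this
  have h2 : HasDerivAt (fun ϖ : ℝ => 2 * ϖ / 3) (2 / 3) ϖ := by
    have := ((hasDerivAt_id ϖ).const_mul (2 : ℝ)).div_const 3
    simpa using this
  have h3 : HasDerivAt (fun ϖ : ℝ => ϖ / 3) (1 / 3) ϖ := by
    have := (hasDerivAt_id ϖ).div_const 3
    simpa using this
  have hu : HasDerivAt (fun ϖ : ℝ => ((2 : ℝ) ^ (ϖ / 3) - 1) * p)
      (Real.log 2 * (1 / 3) * (2 : ℝ) ^ (ϖ / 3) * p) ϖ :=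
    ((h3.const_rpow (by norm_num : (0 : ℝ) < 2)).sub_const 1).mul_const p
  have e : HasDerivAt (fun ϖ : ℝ => d ^ (4 * ϖ / 3) - ((2 : ℝ) ^ (ϖ / 3) - 1) * p * d ^ (2 * ϖ / 3))
      (Real.log d * (4 / 3) * d ^ (4 * ϖ / 3) - (Real.log 2 * (1 / 3) * (2 : ℝ) ^ (ϖ / 3) * p
        * d ^ (2 * ϖ / 3) + ((2 : ℝ) ^ (ϖ / 3) - 1) * p * (Real.log d * (2 / 3) * d ^ (2 * ϖ / 3)))) ϖ :=
    (h1.const_rpow hd).sub (hu.mul (h2.const_rpow hd))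
  exact e.congr_deriv (by ring)

/-- **Alman–Li 2026, Lemma 9.4**: for real `d ≥ 3` and `0 ≤ p ≤ d/3`,
`g(ϖ) = d^{4ϖ/3} − (2^{ϖ/3}−1) p d^{2ϖ/3}` is strictly increasing on `[2, 3]`.
[cite: AlmanLi2026, Lemma 9.4] -/
theorem lemma94 {d p : ℝ} (hd : 3 ≤ d) (hp0 : 0 ≤ p) (hp : p ≤ d / 3) :
    StrictMonoOn (fun ϖ : ℝ => d ^ (4 * ϖ / 3) - ((2 : ℝ) ^ (ϖ / 3) - 1) * p * d ^ (2 * ϖ / 3))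
      (Icc 2 3) := by
  have hd0 : 0 < d := by linarith
  have hd1 : 1 ≤ d := by linarith
  refine strictMonoOn_of_deriv_pos (convex_Icc _ _)
    (fun ϖ _ => (hasDerivAt_lemma94 hd0 p ϖ).continuousAt.continuousWithinAt) ?_
  intro ϖ hϖ
  rw [interior_Icc] at hϖ
  obtain ⟨hϖ0, hϖ1⟩ := hϖ
  rw [(hasDerivAt_lemma94 hd0 p ϖ).deriv]
  obtain ⟨hlog3, hcbrt, hlog2⟩ := lemma93_numerics
  have hL : 1 < Real.log d := hlog3.trans_le (Real.log_le_log (by norm_num) hd)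
  have hz0 : 0 < d ^ (ϖ / 3) := Real.rpow_pos_of_pos hd0 _
  have h2θ : (2 : ℝ) ^ (ϖ / 3) ≤ 2 := by
    calc (2 : ℝ) ^ (ϖ / 3) ≤ (2 : ℝ) ^ (1 : ℝ) :=
          Real.rpow_le_rpow_of_exponent_le (by norm_num) (by linarith)
      _ = 2 := Real.rpow_one 2
  have h2θ1 : 1 ≤ (2 : ℝ) ^ (ϖ / 3) := Real.one_le_rpow (by norm_num) (by linarith)
  have e4 : d ^ (4 * ϖ / 3) = (d ^ (ϖ / 3)) ^ (2 : ℕ) * (d ^ (ϖ / 3)) ^ (2 : ℕ) := by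
    rw [← pow_add, ← Real.rpow_natCast, ← Real.rpow_mul hd0.le]; ring_nf
  have e2 : d ^ (2 * ϖ / 3) = (d ^ (ϖ / 3)) ^ (2 : ℕ) := by
    rw [← Real.rpow_natCast, ← Real.rpow_mul hd0.le]; ring_nf
  -- `(d^{ϖ/3})² ≥ d^{4/3} = d · d^{1/3}`
  have h43 : d * d ^ ((1 : ℝ) / 3) ≤ (d ^ (ϖ / 3)) ^ (2 : ℕ) := by
    calc d * d ^ ((1 : ℝ) / 3) = d ^ ((4 : ℝ) / 3) := by
          rw [show (4 : ℝ) / 3 = 1 + 1 / 3 by norm_num, Real.rpow_add hd0, Real.rpow_one]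
      _ ≤ d ^ (2 * ϖ / 3) := Real.rpow_le_rpow_of_exponent_le hd1 (by linarith)
      _ = (d ^ (ϖ / 3)) ^ (2 : ℕ) := e2
  have hc : (1.44 : ℝ) < d ^ ((1 : ℝ) / 3) :=
    hcbrt.trans_le (Real.rpow_le_rpow (by norm_num) hd (by norm_num))
  have hlog2' : 0 < Real.log 2 := Real.log_pos (by norm_num)
  rw [e4, e2]
  have hbr : 0 < 4 * Real.log d * (d * d ^ ((1 : ℝ) / 3))
      - p * (2 * Real.log 2 + 2 * Real.log d) := by
    nlinarith [mul_pos (by linarith : (0 : ℝ) < Real.log d - 1) (by linarith : (0 : ℝ) < d)]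
  have hderiv : p * (Real.log 2 * (1 / 3) * (2 : ℝ) ^ (ϖ / 3) * (d ^ (ϖ / 3)) ^ (2 : ℕ)
      + ((2 : ℝ) ^ (ϖ / 3) - 1) * (Real.log d * (2 / 3) * (d ^ (ϖ / 3)) ^ (2 : ℕ)))
      ≤ p * ((1 / 3) * (2 * Real.log 2 + 2 * Real.log d)) * (d ^ (ϖ / 3)) ^ (2 : ℕ) := by
    have hsq : 0 ≤ (d ^ (ϖ / 3)) ^ (2 : ℕ) := pow_nonneg hz0.le 2
    rw [mul_assoc p]
    refine mul_le_mul_of_nonneg_left ?_ hp0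
    nlinarith [mul_nonneg (by linarith : (0 : ℝ) ≤ 2 - (2 : ℝ) ^ (ϖ / 3)) (mul_nonneg hlog2'.le hsq),
      mul_nonneg (by linarith : (0 : ℝ) ≤ 2 - (2 : ℝ) ^ (ϖ / 3))
        (mul_nonneg (by linarith : (0:ℝ) ≤ Real.log d) hsq)]
  nlinarith [mul_pos hbr (pow_pos hz0 2), pow_pos hz0 2,
    mul_le_mul_of_nonneg_right (mul_le_mul_of_nonneg_right h43 (by linarith : (0 : ℝ) ≤ Real.log d))
      (pow_nonneg hz0.le 2)]

end AlmanLi2026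

end Literature.Computability.AlgebraicComplexity
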